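import Summits.ABC.ABC.Theorems.IsogenyGlueCongruenceModularDatumExists
import Literature.NumberTheory.Automorphic.CDTTheorem712TwoLiftsProofs
import HarnessLib

/-!
# Route IsogenyGlueCongruence, crux `ModularDatumExists` (stmt-ABC-15126): the crux from ONE
# weight-two modularity lifting statement at `p = 3` (line `Sketch`, card `uniform-lifting-recut`)

The crux `Summit.ABC.ABC.Theses.IsogenyGlueCongruence.ModularDatumExists` is, unconditionally,
"every elliptic curve over `ℚ` is modular" (`modularDatumExists_iff_forall_isModular`,
`IsogenyGlueCongruenceModularDatumExists`).  This file runs Wiles' case analysis in the order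
printed by Conrad–Diamond–Taylor 1999 (proof of Thm. 7.1.2, p. 556) with NO conductor hypothesis
anywhere, so that neither `27 ∤ N_E`, nor the tame/wild split above `3` of BCDT 2001 §2.2, nor
Ogg's formula / the Swan conductor of `V₅E` at `3`, nor the conductor transfer along `E'[5] ≅ E[5]`
enter: the whole `3`-adic input is ONE lifting statement, carried as the hypothesis `hlift3`
(no named fact is introduced, as in `CDTTheorem712TwoLiftsProofs`):

  LIFT(3): for every elliptic `W/ℚ` and framed model `ρ̄` of `E[3]`,
    `ρ̄|_{ℚ(√-3)}` absolutely irreducible → `ρ̄` modular → `E` modular (`BCDT.IsModular W`)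

— character for character the tree's named fact `CDT_theorem_7_2_1` (CDT 1999, Thm. 7.2.1) with its
hypothesis `¬ 27 ∣ N_E` DELETED and residual modularity made explicit.  In print LIFT(3) for
`ρ = ρ_{E,3}` is: Kisin, *Moduli of finite flat group schemes, and modularity*, Ann. of Math. 170
(2009), Cor. 3.5.8 (`ρ` potentially Barsotti–Tate at `p`, `det ρ` cyclotomic, `ρ̄` modular,
`ρ̄|_{ℚ(√-3)}` absolutely irreducible ⇒ `ρ` modular; this covers every `E` with potentially GOOD
reduction at `3`, in particular all the wild cases `27 ∣ N_E` of BCDT — Kisin, Introduction: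
"a more conceptual way of establishing the Shimura–Taniyama–Weil conjecture, especially for
elliptic curves which acquire good reduction over a wildly ramified extension of `ℚ₃`"), together
with CDT 1999 Thm. 7.2.1 itself / Diamond 1996 Thm. 5.4 for `E` potentially multiplicative at `3`
(then `9 ∥ N_E` or `3 ∥ N_E`, so `27 ∤ N_E`); uniformly it is Dieulefait–Pacetti 2023, Thm. 1.4 at
`p = 3`, `k = 2` (Kisin's Fontaine–Mazur theorem with the local restriction at `3` removed by Tung,
Algebra Number Theory 15 (2021), Thm. 4.5), `ρ_{E,3}` being de Rham with Hodge–Tate weights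
`{0, 1}`; "`ρ_{E,3}` modular ⇒ `E` modular" is BCDT's (3) ⇒ (2) (Carayol, Faltings), the reading
already used by `CDT_theorem_7_2_1` / `CDT_theorem_7_2_2`.

Main statements (namespace `Summit.ABC.ABC.Theorems`):

* `modularDatumExists_of_modThree_of_liftThree_of_CDT722_of_switch_of_CDT723` — the crux from
  (a) "`E[3]` absolutely irreducible ⇒ `ρ̄_{E,3}` modular" (Langlands–Tunnell), (b) LIFT(3),
  (c) `CDT_theorem_7_2_2` (LIFT(5)), (d) the `3`–`5` switch in torsion-only form, (e) the modularity
  conclusion of CDT Lemma 7.2.3 (Elkies) — these are exactly the five registered stubs of the line's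
  skeleton `Cruxes/ModularDatumExists/Lines/Sketch.lean`;
* `modularDatumExists_of_langlands_tunnell_of_liftThree_of_CDT722_of_auxiliaryCurve_of_CDT723` —
  the same with (a) and (d) supplied by the tree's named facts `langlands_tunnell` and
  `exists_isTorsionGaloisRep_five_and_surjective_three` (Shepherd-Barron–Taylor), all glue proved;
* `modularDatumExists_iff_liftThree_of_langlands_tunnell_of_CDT722_of_auxiliaryCurve_of_CDT723` —
  **granted those four catalogued facts, the crux is EQUIVALENT to LIFT(3)**: the exact residual
  of line `Sketch`.

Trust base of the crux along this line: {`langlands_tunnell`, LIFT(3), `CDT_theorem_7_2_2`,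
`exists_isTorsionGaloisRep_five_and_surjective_three`, `CDT_lemma_7_2_3_isModular`} — five leaves,
against six for the tree's `exists_isNewformOf_of_wild_of_auxiliaryCurve_of_CDT721_722_723_of_swan`.

## References

* [KisinModuli2009] M. Kisin, Ann. of Math. 170 (2009), 1085–1180: Theorem (Introduction,
  p. 1086) and Cor. 3.5.8 (p. 1172).
* [DieulefaitPacetti2023] L. Dieulefait, A. Pacetti, RACSAM 117 (2023), Thm. 1.4; [Kisin2009]
  M. Kisin, JAMS 22 (2009); [Tung2021] S.-N. Tung, Algebra Number Theory 15 (2021), Thm. 4.5.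
* [ConradDiamondTaylor1999] Thm. 7.2.1, Thm. 7.2.2, Lemma 7.2.3, proof of Thm. 7.1.2 (p. 556);
  [Diamond1996] Thm. 5.4; [BCDTJAMS2001] §2.2; [Gelbart1997] Prop. 1.4.
-/

-- `Summit.<Summit>.<Problem>` is the mandated summit-side namespace (CONVENTIONS §2); for the
-- single-conjunct summit `ABC` the two coincide, so the duplicate `ABC.ABC` is deliberate.
set_option linter.dupNamespace false

noncomputable section

open scoped MatrixGroups
open Literature.NumberTheory.GaloisRepresentations
open Literature.NumberTheory.Automorphic
open Literature.NumberTheory.Automorphic.BCDT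
open Literature.NumberTheory.EllipticCurves.ModularForms

namespace Summit.ABC.ABC.Theorems

/-- **The `3`–`5` switch in torsion-only form, from the Shepherd-Barron–Taylor auxiliary curve.**
Granted the tree's named fact `exists_isTorsionGaloisRep_five_and_surjective_three` (BCDT 2001
§2.2; SBT 1997 §1): for an elliptic `W/ℚ` none of whose framed `ρ̄_{E,3}` is absolutely irreducible
over `ℚ(√-3)` (an idle hypothesis, kept because it is available at that point of the proof) and a
framed model `ρ̄` of `E[5]` absolutely irreducible over `ℚ(√5)`, there is an elliptic `W'/ℚ` with
`W'[5] ≅ W[5]` (the same `ρ̄`) and a framed `ρ̄_{E',3}` absolutely irreducible over `ℚ(√-3)`.  As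
`CDT_three_five_switch_of_exists_isTorsionGaloisRep_five_and_surjective_three` (`CDTTheorem712`),
without `¬ 27 ∣ N_E`: `ρ̄` is absolutely irreducible, has cyclotomic determinant (Weil pairing,
`det_eq_modPCyclotomicCharacter_of_isTorsionGaloisRep_holds`), and a surjective `ρ̄_{E',3}` is
absolutely irreducible over `ℚ(√-3)` (`isAbsIrreducibleOverSqrt_neg_three_of_surjective`).
[cite: ConradDiamondTaylor1999, proof of Thm. 7.1.2 (p. 556)] -/
theorem three_five_switch_of_exists_isTorsionGaloisRep_five_and_surjective_three
    (hE : exists_isTorsionGaloisRep_five_and_surjective_three) :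
    ∀ (W : WeierstrassCurve ℚ) [W.IsElliptic],
      (∀ ρ₃ : ModPGaloisRep ℚ (ZMod 3) 2, W.IsTorsionGaloisRep 3 ρ₃ →
        ¬ ρ₃.IsAbsIrreducibleOverSqrt (-3)) →
      ∀ (ρ : ModPGaloisRep ℚ (ZMod 5) 2), W.IsTorsionGaloisRep 5 ρ → ρ.IsAbsIrreducibleOverSqrt 5 →
      ∃ (W' : WeierstrassCurve ℚ) (_ : W'.IsElliptic), W'.IsTorsionGaloisRep 5 ρ ∧
        ∃ ρ₃' : ModPGaloisRep ℚ (ZMod 3) 2, W'.IsTorsionGaloisRep 3 ρ₃' ∧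
          ρ₃'.IsAbsIrreducibleOverSqrt (-3) := by
  intro W _ _ ρ hρ h5
  obtain ⟨W', hW', hρ', ρ₃, hρ₃, hsurj⟩ := hE ρ h5.isAbsolutelyIrreducible
    (W.det_eq_modPCyclotomicCharacter_of_isTorsionGaloisRep_holds 5 ρ hρ)
  exact ⟨W', hW', hρ', ρ₃, hρ₃, isAbsIrreducibleOverSqrt_neg_three_of_surjective ρ₃ hsurj⟩

/-- **The crux `ModularDatumExists` from the five inputs of line `Sketch`** — Wiles' case analysis
in the order of Conrad–Diamond–Taylor 1999, proof of Thm. 7.1.2 (p. 556), with no conductor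
hypothesis.  Hypotheses: `hmod3` — "`E[3]` absolutely irreducible ⇒ `ρ̄_{E,3}` modular"
(Langlands–Tunnell; Gelbart 1997 Prop. 1.4); `hlift3` — LIFT(3) (Kisin 2009 Cor. 3.5.8 /
Dieulefait–Pacetti 2023 Thm. 1.4 at `p = 3`: `ρ̄_{E,3}|_{ℚ(√-3)}` absolutely irreducible and
`ρ̄_{E,3}` modular ⇒ `E` modular); `h722` — CDT Thm. 7.2.2 (LIFT(5)); `hsw` — the `3`–`5` switch,
torsion-only; `h723` — CDT Lemma 7.2.3, modularity conclusion (Elkies).  Proof: (1) some framed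
`ρ̄_{E,3}` absolutely irreducible over `ℚ(√-3)` ⇒ `E` modular by `hmod3` and `hlift3`; (2) else fix
`ρ̄ = ρ̄_{E,5}` (`exists_isTorsionGaloisRep`); if `ρ̄|_{ℚ(√5)}` is not absolutely irreducible, `h723`;
(3) else `hsw` gives `E'` with `E'[5] ≅ E[5]` and `ρ̄_{E',3}|_{ℚ(√-3)}` absolutely irreducible, `E'`
is modular by (1), so `ρ̄` is modular (`IsModular.isModular_of_isTorsionGaloisRep''`), and `E` is
modular by `h722`; finally `modularDatumExists_iff_forall_isModular`.
[cite: ConradDiamondTaylor1999, proof of Thm. 7.1.2 (p. 556)] -/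
theorem modularDatumExists_of_modThree_of_liftThree_of_CDT722_of_switch_of_CDT723
    (hmod3 : ∀ (W : WeierstrassCurve ℚ) [W.IsElliptic] (ρ : ModPGaloisRep ℚ (ZMod 3) 2),
      W.IsTorsionGaloisRep 3 ρ → FramedRep.IsAbsolutelyIrreducible ρ → ρ.IsModular)
    (hlift3 : ∀ (W : WeierstrassCurve ℚ) [W.IsElliptic] [NeZero (W.conductorNorm ℤ)]
      (ρ : ModPGaloisRep ℚ (ZMod 3) 2), W.IsTorsionGaloisRep 3 ρ →
      ρ.IsAbsIrreducibleOverSqrt (-3) → ρ.IsModular → IsModular W)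
    (h722 : CDT_theorem_7_2_2)
    (hsw : ∀ (W : WeierstrassCurve ℚ) [W.IsElliptic],
      (∀ ρ₃ : ModPGaloisRep ℚ (ZMod 3) 2, W.IsTorsionGaloisRep 3 ρ₃ →
        ¬ ρ₃.IsAbsIrreducibleOverSqrt (-3)) →
      ∀ (ρ : ModPGaloisRep ℚ (ZMod 5) 2), W.IsTorsionGaloisRep 5 ρ → ρ.IsAbsIrreducibleOverSqrt 5 →
      ∃ (W' : WeierstrassCurve ℚ) (_ : W'.IsElliptic), W'.IsTorsionGaloisRep 5 ρ ∧
        ∃ ρ₃' : ModPGaloisRep ℚ (ZMod 3) 2, W'.IsTorsionGaloisRep 3 ρ₃' ∧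
          ρ₃'.IsAbsIrreducibleOverSqrt (-3))
    (h723 : CDT_lemma_7_2_3_isModular) :
    Summit.ABC.ABC.Theses.IsogenyGlueCongruence.ModularDatumExists := by
  refine modularDatumExists_iff_forall_isModular.mpr fun W _ _ ↦ ?_
  -- `E[3]|ℚ(√-3)` absolutely irreducible on some framed model ⇒ `E` modular (for every curve)
  have key : ∀ (V : WeierstrassCurve ℚ) [V.IsElliptic] [NeZero (V.conductorNorm ℤ)]
      (ρ₃ : ModPGaloisRep ℚ (ZMod 3) 2), V.IsTorsionGaloisRep 3 ρ₃ →
      ρ₃.IsAbsIrreducibleOverSqrt (-3) → IsModular V :=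
    fun V _ _ ρ₃ hρ₃ h3 ↦ hlift3 V ρ₃ hρ₃ h3 (hmod3 V ρ₃ hρ₃ h3.isAbsolutelyIrreducible)
  -- (1) some framed `ρ̄_{E,3}` absolutely irreducible over `ℚ(√-3)`
  by_cases h3 : ∃ ρ₃ : ModPGaloisRep ℚ (ZMod 3) 2,
      W.IsTorsionGaloisRep 3 ρ₃ ∧ ρ₃.IsAbsIrreducibleOverSqrt (-3)
  · obtain ⟨ρ₃, hρ₃, h3i⟩ := h3
    exact key W ρ₃ hρ₃ h3i
  push Not at h3
  -- (2) fix `ρ̄ = ρ̄_{E,5}`; Lemma 7.2.3 if `ρ̄|ℚ(√5)` is not absolutely irreducible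
  obtain ⟨ρ, hρ⟩ := W.exists_isTorsionGaloisRep 5
  by_cases h5 : ρ.IsAbsIrreducibleOverSqrt 5
  swap
  · obtain ⟨ρ₃, hρ₃⟩ := W.exists_isTorsionGaloisRep 3
    exact h723 W ρ hρ h5 ρ₃ hρ₃ (h3 ρ₃ hρ₃)
  -- (3) the `3`–`5` switch
  obtain ⟨W', hW', hρ', ρ₃', hρ₃', h3'⟩ := hsw W h3 ρ hρ h5
  haveI := hW'
  haveI : NeZero (W'.conductorNorm ℤ) := ⟨(WeierstrassCurve.conductorNorm_pos_holds W').ne'⟩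
  have hE' : IsModular W' := key W' ρ₃' hρ₃' h3'
  exact h722 W ρ hρ h5 (hE'.isModular_of_isTorsionGaloisRep'' hρ')

/-- **The crux `ModularDatumExists` from LIFT(3) and four catalogued named facts of the tree**:
Langlands–Tunnell (`langlands_tunnell`, every `σ`; it gives `hmod3` by
`modThree_of_langlands_tunnell`), LIFT(3) (`hlift3`, Kisin 2009 Cor. 3.5.8 / Dieulefait–Pacetti
2023 Thm. 1.4 at `p = 3`), CDT Thm. 7.2.2 (`CDT_theorem_7_2_2`), the Shepherd-Barron–Taylor
auxiliary curve (`exists_isTorsionGaloisRep_five_and_surjective_three`, which gives the switch by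
`three_five_switch_of_exists_isTorsionGaloisRep_five_and_surjective_three`) and the modularity
conclusion of CDT Lemma 7.2.3 (`CDT_lemma_7_2_3_isModular`).  Trust base of the crux along line
`Sketch`: these five, every glue step proved. [cite: KisinModuli2009, Cor. 3.5.8] -/
theorem modularDatumExists_of_langlands_tunnell_of_liftThree_of_CDT722_of_auxiliaryCurve_of_CDT723
    (hLT : ∀ σ : FramedArtinRep ℚ 2, langlands_tunnell σ)
    (hlift3 : ∀ (W : WeierstrassCurve ℚ) [W.IsElliptic] [NeZero (W.conductorNorm ℤ)]
      (ρ : ModPGaloisRep ℚ (ZMod 3) 2), W.IsTorsionGaloisRep 3 ρ →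
      ρ.IsAbsIrreducibleOverSqrt (-3) → ρ.IsModular → IsModular W)
    (h722 : CDT_theorem_7_2_2) (hE : exists_isTorsionGaloisRep_five_and_surjective_three)
    (h723 : CDT_lemma_7_2_3_isModular) :
    Summit.ABC.ABC.Theses.IsogenyGlueCongruence.ModularDatumExists :=
  modularDatumExists_of_modThree_of_liftThree_of_CDT722_of_switch_of_CDT723
    (modThree_of_langlands_tunnell hLT) hlift3 h722
    (three_five_switch_of_exists_isTorsionGaloisRep_five_and_surjective_three hE) h723

/-- **Conversely, the crux implies LIFT(3)** trivially: `ModularDatumExists` makes every elliptic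
curve over `ℚ` modular (`modularDatumExists_iff_forall_isModular`), so the conclusion of LIFT(3)
holds with its hypotheses unused. [folklore] -/
theorem liftThree_of_modularDatumExists
    (h : Summit.ABC.ABC.Theses.IsogenyGlueCongruence.ModularDatumExists) :
    ∀ (W : WeierstrassCurve ℚ) [W.IsElliptic] [NeZero (W.conductorNorm ℤ)]
      (ρ : ModPGaloisRep ℚ (ZMod 3) 2), W.IsTorsionGaloisRep 3 ρ →
      ρ.IsAbsIrreducibleOverSqrt (-3) → ρ.IsModular → IsModular W :=
  fun W _ _ _ _ _ _ ↦ modularDatumExists_iff_forall_isModular.mp h W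

/-- **The exact residual of line `Sketch`: granted Langlands–Tunnell, CDT Thm. 7.2.2, the
Shepherd-Barron–Taylor auxiliary curve and CDT Lemma 7.2.3 (modularity), the crux
`ModularDatumExists` is EQUIVALENT to the single weight-two lifting statement LIFT(3)**
(`modularDatumExists_of_langlands_tunnell_of_liftThree_of_CDT722_of_auxiliaryCurve_of_CDT723` and
`liftThree_of_modularDatumExists`).  What the crux asserts beyond those four catalogued facts is
exactly Kisin's Cor. 3.5.8 at `p = 3` for `ρ_{E,3}` (with Diamond 1996 Thm. 5.4 / CDT Thm. 7.2.1 in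
the potentially multiplicative case). [cite: KisinModuli2009, Cor. 3.5.8] -/
theorem modularDatumExists_iff_liftThree_of_langlands_tunnell_of_CDT722_of_auxiliaryCurve_of_CDT723
    (hLT : ∀ σ : FramedArtinRep ℚ 2, langlands_tunnell σ)
    (h722 : CDT_theorem_7_2_2) (hE : exists_isTorsionGaloisRep_five_and_surjective_three)
    (h723 : CDT_lemma_7_2_3_isModular) :
    Summit.ABC.ABC.Theses.IsogenyGlueCongruence.ModularDatumExists ↔
      ∀ (W : WeierstrassCurve ℚ) [W.IsElliptic] [NeZero (W.conductorNorm ℤ)]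
        (ρ : ModPGaloisRep ℚ (ZMod 3) 2), W.IsTorsionGaloisRep 3 ρ →
        ρ.IsAbsIrreducibleOverSqrt (-3) → ρ.IsModular → IsModular W :=
  ⟨liftThree_of_modularDatumExists, fun hlift3 ↦
    modularDatumExists_of_langlands_tunnell_of_liftThree_of_CDT722_of_auxiliaryCurve_of_CDT723 hLT
      hlift3 h722 hE h723⟩

end Summit.ABC.ABC.Theorems

end
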